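import Summits.HodgeConjecture.HodgeConjecture.Theorems.HeckePrymWeilSummitOffWeilSectorLefschetzBInstances
import Literature.AlgebraicGeometry.HodgeTheory.MotivatedClassesAssembly
import Literature.AlgebraicGeometry.HodgeTheory.MotivatedClassesProofs
import Literature.AlgebraicGeometry.HodgeTheory.HardLefschetzNFold
import HarnessLib

/-!
# Route HeckePrymWeil — `SummitOffWeilSector` (stmt-HodgeConjecture-14374), line `motivated-anchor-split`: conjecture `B` below the middle degree from the multiplicativity of algebraic classes, and the reduction of Stub 1 to its open core (the inverse Lefschetz isomorphisms)

Stub `stub_lefschetzStandardB` of the line asks for Grothendieck's standard conjecture of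
Lefschetz type for every smooth projective complex variety in André's `*_L`-form
(`StandardConjectureBStar d Z η`: every Lefschetz involution `*_L : Hᵃ(Z(ℂ); ℂ) → Hᵇ(Z(ℂ); ℂ)`,
`a + b = 2d`, of a polarisation class `η` is induced by an algebraic class on `Z × Z`). André
(*Pour une théorie inconditionnelle des motifs*, Publ. Math. IHÉS 83 (1996), §0.2 p. 7, §1.1 p. 10,
§3.2 Remarque p. 21): "`*_L = Σᵢ (L^{d-i})^{±1} πⁱ`" — BELOW the middle degree (`a ≤ d`) the
involution is the ITERATED LEFSCHETZ OPERATOR `L^{d-a} = (η ∪ ·)^{d-a}`, above it the INVERSE of a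
hard-Lefschetz isomorphism. This file proves, on the tree's real carriers:

* `lefschetzPow_apply_eq_cupProduct_pow` — `Lʲ x = ηʲ ∪ x` with `ηʲ = Lʲ 1 ∈ H²ʲ` (associativity of
  the Alexander–Whitney cup product, Hatcher §3.2 p. 211, the tree's `cupProduct_assoc`);
* `lefschetzPowTo_one_mem_algebraicClasses` — `ηʲ ∈ Nʲ H²ʲ` for `η ∈ N¹ H²`, GRANTED the
  multiplicativity `Nᵃ ∪ Nᵇ ⊆ Nᵃ⁺ᵇ` of algebraic classes (the line's Stub 4,
  `Voisin2003_cupProduct_algebraicClasses`, Voisin II Prop. 9.20; taken as a hypothesis, never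
  assumed silently);
* `standardConjectureBStar_of_le_middle` — hence **`B(X)` in every degree `a ≤ dim X`**, granted
  Stub 4: `*_L = Lʲ = (· ∪ ηʲ)` (graded commutativity, `ηʲ` of even degree) is the algebraic
  correspondence `[Δ_* ηʲ]^*` (lead c1's `isAlgebraicCorrespondence_cupProduct_right`, p138014);
* `standardConjectureBStar_of_aboveMiddle` — **the REDUCTION OF STUB 1 TO ITS OPEN CORE**: granted
  Stub 4, conjecture `B` for all smooth projective complex varieties follows from its instances in
  the degrees `d < a < 2d` ALONE, i.e. from the algebraicity of the inverse Lefschetz isomorphisms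
  `(L^{a-d})⁻¹ : Hᵃ → H^{2d-a}` — Grothendieck's `B(X)` proper ("the `Λ`-operation is algebraic",
  Bombay 1968 §3; equivalently `θⁱ = (L^{d-i})⁻¹` algebraic for `i < d`, Kleiman 1968 §2) — the
  degrees `a ≤ d` being `standardConjectureBStar_of_le_middle` and the degree `a = 2d` lead c1's
  `standardConjectureBStar_of_eq_top` (every map `H²ᵈ → H⁰` is an algebraic correspondence).

So after this file the line's Stub 1 is exactly `B` above the middle degree (registered as
`stub_lefschetzStandardBAboveMiddle` in the reshaped skeleton), which is where the conjecture
lives: known for curves (vacuous), surfaces (Lieberman–Kleiman via the Picard variety), abelian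
varieties (Lieberman 1968), generalised flag varieties, complete intersections, and open in general.
No definition and no named fact is introduced.

## References

* [Andre1996Motifs] Y. André, Pour une théorie inconditionnelle des motifs, Publ. Math. IHÉS 83
  (1996), §0.2 (p. 7), §1.1 (p. 10), §3.2 Remarque (p. 21).
* [Grothendieck1968] A. Grothendieck, Standard conjectures on algebraic cycles, Bombay 1968, §3
  p. 196.
* [Kleiman1968] S. Kleiman, Algebraic cycles and the Weil conjectures, in: Dix exposés (1968), §2
  (the operators `Λ`, `θⁱ`, `B(X) ⟺ θⁱ algebraic for i ≤ n - 1`, Prop. 2.3).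
* [VoisinHodgeII2003] C. Voisin, Hodge Theory and Complex Algebraic Geometry II, CUP 2003, §9.2.4
  Prop. 9.20.
* [HatcherAT2002] A. Hatcher, Algebraic Topology, CUP 2002, §3.2 p. 211 and Thm. 3.11.
-/

noncomputable section

-- every declaration of this problem lives in `Summit.HodgeConjecture.HodgeConjecture.…` (summit = sub-problem)
set_option linter.dupNamespace false

open CategoryTheory AlgebraicGeometry MonoidalCategory CartesianMonoidalCategory
open Literature.AlgebraicGeometry.Motives Literature.AlgebraicGeometry.HodgeTheory
open Literature.AlgebraicTopology.SingularHomology Literature.Geometry.Kaehler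

namespace Summit.HodgeConjecture.HodgeConjecture.Theorems

variable {n : ℕ} {X : SchemeOver ℂ}

/-! ### `Lʲ x = ηʲ ∪ x` -/

/-- **The iterated Lefschetz operator is cup product with a power of the class**: for
`η ∈ H²(X(ℂ); ℂ)` and `x ∈ Hᵃ(X(ℂ); ℂ)`, `Lʲ x = ηʲ ∪ x`, where `ηʲ = Lʲ 1 = η ∪ (η ∪ ⋯ (η ∪ 1)) ∈ H²ʲ`
(`lefschetzPowTo η j 0 (2j)` of the unit). By induction on `j`: `L⁰ x = x = 1 ∪ x`, and
`L(Lʲ x) = η ∪ (ηʲ ∪ x) = (η ∪ ηʲ) ∪ x` by the associativity of the cup product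
(Hatcher §3.2 p. 211). [cite: HatcherAT2002, §3.2 p. 211] [cite: VoisinHodgeI2002, §6.2.3] -/
theorem lefschetzPow_apply_eq_cupProduct_pow (η : complexBetti X 2) :
    ∀ (j a : ℕ) (hm : 0 + 2 * j = 2 * j) (h : 2 * j + a = a + 2 * j) (x : complexBetti X a),
      lefschetzPow η j a x =
        cupProduct h (lefschetzPowTo η j 0 (2 * j) hm (singularCohomology.one ℂ (ComplexPoints X))) x
  | 0, a, hm, h, x => by
    have h1 : lefschetzPowTo η 0 0 (2 * 0) hm (singularCohomology.one ℂ (ComplexPoints X)) =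
        singularCohomology.one ℂ (ComplexPoints X) := rfl
    rw [h1, lefschetzPow_zero, LinearMap.id_apply]
    exact (one_cupProduct x).symm
  | j + 1, a, hm, h, x => by
    rw [lefschetzPow_succ, LinearMap.comp_apply, lefschetzOperator_apply,
      lefschetzPow_apply_eq_cupProduct_pow η j a (by omega) (by omega) x,
      lefschetzPowTo_succ_apply η j 0 (2 * j) (2 * (j + 1)) (by omega) hm (by omega),
      lefschetzOperator_apply]
    exact (cupProduct_assoc _ _ _ _ η _ x).symm

/-! ### Powers of a divisor-supported class are algebraic, granted the multiplicativity -/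

/-- **`ηʲ ∈ Nʲ H²ʲ(X(ℂ); ℂ)` for `η ∈ N¹ H²`**, granted the multiplicativity of algebraic classes
on smooth projective varieties (`Voisin2003_cupProduct_algebraicClasses`, Voisin II Prop. 9.20:
`cl(Z) ∪ cl(Z') = cl(Z · Z')`): `η⁰ = 1 ∈ N⁰ H⁰ = H⁰` (`algebraicClasses_zero`) and
`ηʲ⁺¹ = η ∪ ηʲ ∈ N¹ ∪ Nʲ ⊆ Nʲ⁺¹`. [cite: VoisinHodgeII2003, §9.2.4 Prop. 9.20] -/
theorem lefschetzPowTo_one_mem_algebraicClasses (hcup : Voisin2003_cupProduct_algebraicClasses)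
    (hX : IsSmoothProjective n X) {η : complexBetti X 2} (hη : η ∈ algebraicClasses X 1) :
    ∀ (j : ℕ) (hm : 0 + 2 * j = 2 * j),
      lefschetzPowTo η j 0 (2 * j) hm (singularCohomology.one ℂ (ComplexPoints X)) ∈
        algebraicClasses X j
  | 0, hm => by
    have h1 : lefschetzPowTo η 0 0 (2 * 0) hm (singularCohomology.one ℂ (ComplexPoints X)) =
        singularCohomology.one ℂ (ComplexPoints X) := rfl
    rw [h1, algebraicClasses_zero]
    exact Submodule.mem_top
  | j + 1, hm => by
    rw [lefschetzPowTo_succ_apply η j 0 (2 * j) (2 * (j + 1)) (by omega) hm (by omega),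
      lefschetzOperator_apply]
    have ih := lefschetzPowTo_one_mem_algebraicClasses hcup hX hη j (by omega)
    exact (cupProduct_mem_supportedClasses_congr (two_mul_add_two_mul 1 j) _
      (show 1 + j = j + 1 by omega) η _).1 (hcup hX hη ih)

/-! ### `B(X)` below (and in) the middle degree, granted the multiplicativity -/

/-- **Conjecture `B(X)` in every degree `a ≤ dim X`, granted the multiplicativity of algebraic
classes.** For `X` smooth projective of dimension `n`, a polarisation class `η`, and `a + b = 2n`
with `a ≤ n` (so `b = a + 2j`, `a + j = n`), André's Lefschetz involution
`*_L : Hᵃ(X(ℂ); ℂ) → Hᵇ(X(ℂ); ℂ)` is `Lʲ` ("donnée en chaque degré par l'isomorphisme de Lefschetz",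
§0.2; `lefschetzInvolution_apply_of_le`), i.e. `x ↦ ηʲ ∪ x = x ∪ ηʲ` (`ηʲ` has even degree; graded
commutativity, Hatcher Thm. 3.11), which is the algebraic correspondence `[Δ_* ηʲ]^*`
(`isAlgebraicCorrespondence_cupProduct_right`) because `ηʲ ∈ Nʲ H²ʲ`
(`lefschetzPowTo_one_mem_algebraicClasses`, under `Voisin2003_cupProduct_algebraicClasses`).
[cite: Andre1996Motifs, §0.2 (p. 7), §1.1 (p. 10) and §3.2 Remarque (p. 21)]
[cite: Grothendieck1968, §3 p. 196 (B(X))] [cite: HatcherAT2002, §3.2 Thm. 3.11] -/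
theorem standardConjectureBStar_of_le_middle (hcup : Voisin2003_cupProduct_algebraicClasses)
    (hX : IsSmoothProjective n X) {η : complexBetti X 2} (hη : IsPolarizationClass n X η)
    {a b : ℕ} (hab : a + b = 2 * n) (ha : a ≤ n) :
    IsAlgebraicCorrespondence n n X X (lefschetzInvolution hη.hasHardLefschetz hab) := by
  obtain ⟨j, hj⟩ : ∃ j, a + j = n := ⟨n - a, by omega⟩
  obtain rfl : b = a + 2 * j := by omega
  have hηj := lefschetzPowTo_one_mem_algebraicClasses hcup hX hη.mem_algebraicClasses j (by omega)
  have heq : lefschetzInvolution hη.hasHardLefschetz hab =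
      (cupProduct (rfl : a + 2 * j = a + 2 * j)).flip
        (lefschetzPowTo η j 0 (2 * j) (by omega) (singularCohomology.one ℂ (ComplexPoints X))) := by
    refine LinearMap.ext fun c ↦ ?_
    rw [lefschetzInvolution_apply_of_le hη.hasHardLefschetz hj hab c, LinearMap.flip_apply,
      lefschetzPow_apply_eq_cupProduct_pow η j a (by omega) (by omega) c,
      cupProduct_gradedComm_holds ℂ _ (show 2 * j + a = a + 2 * j by omega) rfl _ c]
    rw [show ((-1 : ℂ) ^ (2 * j * a)) = 1 by rw [mul_assoc, pow_mul, neg_one_sq, one_pow], one_smul]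
  rw [heq]
  exact isAlgebraicCorrespondence_cupProduct_right hX rfl (by omega) hηj

/-! ### Stub 1 reduced to its open core: `B` above the middle degree -/

/-- **Conjecture `B` for all smooth projective complex varieties from its instances ABOVE the
middle degree, granted the multiplicativity of algebraic classes** (the reduction of the line's
Stub 1 to its open core). If for every smooth projective `Z` of dimension `d`, every polarisation
class `η` and every degree `d < a < 2d` the Lefschetz involution `*_L : Hᵃ(Z(ℂ); ℂ) → H^{2d-a}(Z(ℂ); ℂ)`
— there the INVERSE of the hard-Lefschetz isomorphism `L^{a-d}`, i.e. Grothendieck's `B(Z)` /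
Kleiman's "`θⁱ` algebraic for `i < d`" — is induced by an algebraic correspondence, then
`StandardConjectureBStar d Z η` holds in full: the degrees `a ≤ d` are
`standardConjectureBStar_of_le_middle` (under `Voisin2003_cupProduct_algebraicClasses`) and the
degree `a = 2d` is `standardConjectureBStar_of_eq_top` (every linear map `H²ᵈ → H⁰` is an algebraic
correspondence). [cite: Grothendieck1968, §3 p. 196 (B(X))] [cite: Kleiman1968, §2 Prop. 2.3]
[cite: Andre1996Motifs, §3.2 Remarque (p. 21)] -/
theorem standardConjectureBStar_of_aboveMiddle (hcup : Voisin2003_cupProduct_algebraicClasses)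
    (hBup : ∀ ⦃d : ℕ⦄ ⦃Z : SchemeOver ℂ⦄ ⦃η : complexBetti Z 2⦄ (hZ : IsSmoothProjective d Z)
      (hη : IsPolarizationClass d Z η) ⦃a b : ℕ⦄ (hab : a + b = 2 * d), d < a → a < 2 * d →
        IsAlgebraicCorrespondence d d Z Z (lefschetzInvolution hη.hasHardLefschetz hab)) :
    ∀ (d : ℕ) (Z : SchemeOver ℂ) (η : complexBetti Z 2), IsSmoothProjective d Z →
      StandardConjectureBStar d Z η := by
  intro d Z η hZ hη a b hab
  rcases le_or_gt a d with ha | ha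
  · exact standardConjectureBStar_of_le_middle hcup hZ hη hab ha
  rcases lt_or_ge a (2 * d) with h2 | h2
  · exact hBup hZ hη hab ha h2
  · exact standardConjectureBStar_of_eq_top hZ hη hab (by omega)

/-- **Registered sub-goal `stub_lefschetzStandardB_of_aboveMiddle` of stmt-HodgeConjecture-14374**
(implication form of `standardConjectureBStar_of_aboveMiddle`): the line's Stub 1 — conjecture `B`
in André's `*_L`-form for every smooth projective complex variety — follows from the
multiplicativity of algebraic classes (Stub 4) and the algebraicity of the Lefschetz involutions in
the degrees `d < a < 2d` only (the inverse Lefschetz isomorphisms: Grothendieck's `B(X)` proper).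
[cite: Grothendieck1968, §3 p. 196 (B(X))] [cite: Andre1996Motifs, §3.2 Remarque (p. 21)] -/
theorem stub_lefschetzStandardB_of_aboveMiddle :
    Voisin2003_cupProduct_algebraicClasses →
    (∀ ⦃d : ℕ⦄ ⦃Z : SchemeOver ℂ⦄ ⦃η : complexBetti Z 2⦄ (hZ : IsSmoothProjective d Z)
      (hη : IsPolarizationClass d Z η) ⦃a b : ℕ⦄ (hab : a + b = 2 * d), d < a → a < 2 * d →
        IsAlgebraicCorrespondence d d Z Z (lefschetzInvolution hη.hasHardLefschetz hab)) →
    ∀ (d : ℕ) (Z : SchemeOver ℂ) (η : complexBetti Z 2), IsSmoothProjective d Z →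
      StandardConjectureBStar d Z η :=
  standardConjectureBStar_of_aboveMiddle

end Summit.HodgeConjecture.HodgeConjecture.Theorems

end
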